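import Mathlib
import HarnessLib
import Summits.Ventures.LatticeQCDFlow.Exactness.SUNResidualIsotopy

/-!
# The right-trivialised tangential operator of the `SU(N)` residual isotopy: invertible at every configuration, for every `N`

HONEST FRAMING: exact (Metropolis-corrected) sampling algorithms for lattice gauge theory;
figures of merit are autocorrelation/cost numbers at stated couplings and volumes; no
continuum-physics claim.

Venture `LatticeQCDFlow` (cell pub-lqcd), topic `Exactness`; FANOUT row 10 (`eng-equiv`; engine
modules `equiv/residual.py`, `flows_jax/residual_flow.py`).  NEW WORK of the cell, file 3 of the series on
the residual-layer Jacobian for every `N` (after `SUNResidualLayerVelocity`, `SUNResidualIsotopy`).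
Setting and local notation `famb[τ]` as in `SUNResidualIsotopy` (the masked residual isotopy
`U ↦ e^{τ Q a y (U a)} U a` on active links, realised ambiently by `C²` exponents `Qamb a`).  No
definition is introduced; every operator below is a Fréchet derivative of an explicit map, so that
all of them live in one and the same normed operator algebra:

* (the elementary operators — right multiplication `Y ↦ Y m`, evaluation at a link, insertion at a
  link, read as `fderiv`s of themselves, and `fderiv_suProj_idem` — live in `SUNResidualIsotopy`);
* the TANGENTIAL OPERATOR (local notation)
  `Top[τ, W, a] = 𝒫 ∘ B ∘ 𝒫 + (1 − 𝒫)`, `B X = (D_W famb[τ](W) · single a (X W_a))_a · (famb[τ] W a)ᴴ`,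
  `𝒫 = fderiv ℝ suProj 0` (Lüscher's projection onto `𝔰𝔲(n)`): `residualTangentBlock_apply`,
  `residualTangentOp_apply`, `suProj_eq_self_of_residualTangentOp_eq` (`Top x ∈ 𝔰𝔲(n) ⇒ x ∈ 𝔰𝔲(n)`,
  pure block algebra);
* **`isUnit_residualTangentOp`** — at every `SU(n)^E` configuration and every `|τ| ≤ 1` the operator
  is a UNIT (file 1's `isUnit_block_operator`: on `𝔰𝔲(n)` the block `B` takes values in `𝔰𝔲(n)` and is
  bounded below by `1 − |τ| κ a y > 0`, `SUNResidualIsotopy.fderiv_residualIsotopy_single_self`).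
  Hence `X ↦ Top⁻¹ X` solves the linear equation "velocity of the active link `a` under the isotopy
  `=` prescribed element of `𝔰𝔲(n)`", which is how the next file builds the generator of the inverse
  family.

Printed counterparts, NAMED ONLY: M. Lüscher, CMP 293 (2010) 899, §3; Abbott et al.,
arXiv:2305.02402 §4.2; Morningstar–Peardon, PRD 69 (2004) 054501.
-/

noncomputable section

namespace Summit.Ventures.LatticeQCDFlow.Exactness

open Literature.MathematicalPhysics.QuantumFieldTheory
open Literature.MathematicalPhysics.QuantumFieldTheory.Luscher2010
open Literature.MathematicalPhysics.QuantumFieldTheory.WilsonFlow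
open Filter Set
open scoped Matrix Matrix.Norms.Frobenius Topology ContDiff

variable {d L n : ℕ} [NeZero L]

section Operator

variable (p : Edge d L → Prop) [DecidablePred p]
  (Q : {e : Edge d L // p e} → ({f : Edge d L // ¬p f} → Matrix.specialUnitaryGroup (Fin n) ℂ) →
    Matrix (Fin n) (Fin n) ℂ → Matrix (Fin n) (Fin n) ℂ)
  (κ : {e : Edge d L // p e} → ({f : Edge d L // ¬p f} → Matrix.specialUnitaryGroup (Fin n) ℂ) → ℝ)
  (Qamb : {e : Edge d L // p e} → AmbConfig d L n → Matrix (Fin n) (Fin n) ℂ)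

set_option quotPrecheck false in
/-- The residual isotopy at time `τ` (local notation, as in `SUNResidualIsotopy`). -/
local notation "famb[" τ "]" => (fun (W : AmbConfig d L n) (e : Edge d L) =>
  if h : p e then NormedSpace.exp ((τ : ℝ) • Qamb ⟨e, h⟩ W) * W e else W e)

set_option quotPrecheck false in
/-- The block `B` of the tangential operator (local notation):
`Blk[τ, W, a] X = (D_W famb[τ](W) · single a (X W_a))_a · (famb[τ] W a)ᴴ`, every factor an `fderiv`. -/
local notation "Blk[" τ ", " W ", " a "]" =>
  ((fderiv ℝ (fun Y : Matrix (Fin n) (Fin n) ℂ => Y * ((famb[τ]) W a)ᴴ) 0).comp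
    ((fderiv ℝ (fun W' : AmbConfig d L n => W' a) 0).comp
      ((fderiv ℝ (famb[τ]) W).comp
        ((fderiv ℝ (fun Y : Matrix (Fin n) (Fin n) ℂ => (Pi.single a Y : AmbConfig d L n)) 0).comp
          (fderiv ℝ (fun Y : Matrix (Fin n) (Fin n) ℂ => Y * W a) 0)))))

set_option quotPrecheck false in
/-- The tangential operator of the isotopy at `(τ, W)` on the active link `a` (local notation):
`Top[τ, W, a] = 𝒫 ∘ B ∘ 𝒫 + (1 − 𝒫)` with `𝒫 = fderiv ℝ suProj 0`. -/
local notation "Top[" τ ", " W ", " a "]" =>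
  ((fderiv ℝ (suProj (n := n)) 0).comp ((Blk[τ, W, a]).comp (fderiv ℝ (suProj (n := n)) 0)) +
    (ContinuousLinearMap.id ℝ (Matrix (Fin n) (Fin n) ℂ) - fderiv ℝ (suProj (n := n)) 0))

/-! ## How the operators act -/

omit [NeZero L] in
/-- **How the block acts.** -/
theorem residualTangentBlock_apply (τ : ℝ) (W : AmbConfig d L n) (a : Edge d L)
    (X : Matrix (Fin n) (Fin n) ℂ) :
    (Blk[τ, W, a]) X = (fderiv ℝ (famb[τ]) W (Pi.single a (X * W a))) a * ((famb[τ]) W a)ᴴ := by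
  change fderiv ℝ (fun Y : Matrix (Fin n) (Fin n) ℂ => Y * ((famb[τ]) W a)ᴴ) 0
      (fderiv ℝ (fun W' : AmbConfig d L n => W' a) 0
        (fderiv ℝ (famb[τ]) W
          (fderiv ℝ (fun Y : Matrix (Fin n) (Fin n) ℂ => (Pi.single a Y : AmbConfig d L n)) 0
            (fderiv ℝ (fun Y : Matrix (Fin n) (Fin n) ℂ => Y * W a) 0 X)))) = _
  rw [fderiv_mulRight_apply, fderiv_singleLink_apply, fderiv_evalLink_apply, fderiv_mulRight_apply]

omit [NeZero L] in
/-- **How the tangential operator acts.** -/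
theorem residualTangentOp_apply (τ : ℝ) (W : AmbConfig d L n) (a : Edge d L) (X : Matrix (Fin n) (Fin n) ℂ) :
    (Top[τ, W, a]) X = suProj ((fderiv ℝ (famb[τ]) W (Pi.single a (suProj X * W a))) a * ((famb[τ]) W a)ᴴ)
      + (X - suProj X) := by
  change fderiv ℝ (suProj (n := n)) 0 ((Blk[τ, W, a]) (fderiv ℝ (suProj (n := n)) 0 X)) +
    (X - fderiv ℝ (suProj (n := n)) 0 X) = _
  rw [residualTangentBlock_apply]
  simp only [fderiv_suProj_apply]

omit [NeZero L] in
/-- **If `Top x` lies in `𝔰𝔲(n)` then so does `x`** (block structure and idempotency of `𝒫`; no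
hypothesis on `(τ, W)`). -/
theorem suProj_eq_self_of_residualTangentOp_eq (τ : ℝ) (W : AmbConfig d L n) (a : Edge d L)
    {x y : Matrix (Fin n) (Fin n) ℂ} (hxy : (Top[τ, W, a]) x = y) (hy : suProj y = y) : suProj x = x := by
  rw [residualTangentOp_apply] at hxy
  have h1 := congrArg suProj hxy
  rw [hy, suProj_add, suProj_suProj, suProj_sub, suProj_suProj, sub_self, add_zero] at h1
  rw [h1] at hxy
  have h2 : x - suProj x = 0 := add_eq_left.mp hxy
  exact (sub_eq_zero.mp h2).symm

omit [NeZero L] in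
/-- **Right inverse on units**: if `Top` is a unit, `Top (Top⁻¹ y) = y` for the operator inverse
`ContinuousLinearMap.inverse`. -/
theorem residualTangentOp_inverse_apply (τ : ℝ) (W : AmbConfig d L n) (a : Edge d L)
    (hT : IsUnit (Top[τ, W, a])) (y : Matrix (Fin n) (Fin n) ℂ) :
    (Top[τ, W, a]) (ContinuousLinearMap.inverse (Top[τ, W, a]) y) = y := by
  set e := ContinuousLinearEquiv.unitsEquiv ℝ (Matrix (Fin n) (Fin n) ℂ) hT.unit with he
  have hecoe : (e : Matrix (Fin n) (Fin n) ℂ →L[ℝ] Matrix (Fin n) (Fin n) ℂ) = Top[τ, W, a] := by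
    ext x
    rfl
  rw [← hecoe, ContinuousLinearMap.inverse_equiv]
  exact e.apply_symm_apply y

/-! ## Invertibility at `SU(n)^E` configurations -/

/-- **The tangential operator is invertible at every `SU(n)^E` configuration, for `|τ| ≤ 1`**
(indeed whenever `|τ| κ a y < 1`): by file 1's `isUnit_block_operator` with `P = 𝒫` and the block
`B` of `Top`, whose restriction to `𝔰𝔲(n)` takes values in `𝔰𝔲(n)` and is injective
(`fderiv_residualIsotopy_single_self`). -/
theorem isUnit_residualTangentOp (hQ2 : ∀ a, ContDiff ℝ 2 (Qamb a))
    (hQ : ∀ a y, ∀ U ∈ Matrix.specialUnitaryGroup (Fin n) ℂ, (Q a y U)ᴴ = -Q a y U ∧ (Q a y U).trace = 0)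
    (hlip : ∀ a y, ∀ U ∈ Matrix.specialUnitaryGroup (Fin n) ℂ, ∀ V ∈ Matrix.specialUnitaryGroup (Fin n) ℂ,
      frobNorm (Q a y U - Q a y V) ≤ κ a y * frobNorm (U - V))
    (hκ0 : ∀ a y, 0 ≤ κ a y) (hκ : ∀ a y, κ a y < 1)
    (hQambQ : ∀ a (U : GaugeConfig d L (Matrix.specialUnitaryGroup (Fin n) ℂ)),
      Qamb a (coeConfig U) = Q a (fun f => U f) (U a.1 : Matrix (Fin n) (Fin n) ℂ))
    {τ : ℝ} (hτ : |τ| ≤ 1) (U : GaugeConfig d L (Matrix.specialUnitaryGroup (Fin n) ℂ))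
    {a : Edge d L} (ha : p a) : IsUnit (Top[τ, coeConfig U, a]) := by
  have hfmem : NormedSpace.exp (τ • Qamb ⟨a, ha⟩ (coeConfig U)) * (U a : Matrix (Fin n) (Fin n) ℂ) ∈
      Matrix.specialUnitaryGroup (Fin n) ℂ := by
    have hm := residualIsotopy_mem p Q Qamb hQ hQambQ τ U a
    simpa only [ha, ↓reduceDIte, coeConfig_apply] using hm
  have hfU : star (NormedSpace.exp (τ • Qamb ⟨a, ha⟩ (coeConfig U)) * (U a : Matrix (Fin n) (Fin n) ℂ)) *
      (NormedSpace.exp (τ • Qamb ⟨a, ha⟩ (coeConfig U)) * (U a : Matrix (Fin n) (Fin n) ℂ)) = 1 :=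
    Matrix.mem_unitaryGroup_iff'.mp (Matrix.mem_specialUnitaryGroup_iff.mp hfmem).1
  have hBapply : ∀ x : Matrix (Fin n) (Fin n) ℂ, (Blk[τ, coeConfig U, a]) x =
      (fderiv ℝ (famb[τ]) (coeConfig U) (Pi.single a (x * (U a : Matrix (Fin n) (Fin n) ℂ)))) a *
        (NormedSpace.exp (τ • Qamb ⟨a, ha⟩ (coeConfig U)) * (U a : Matrix (Fin n) (Fin n) ℂ))ᴴ := by
    intro x
    rw [residualTangentBlock_apply]
    simp only [ha, ↓reduceDIte, coeConfig_apply]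
  refine isUnit_block_operator (fderiv ℝ (suProj (n := n)) 0) (Blk[τ, coeConfig U, a])
    fderiv_suProj_idem (fun x hx => ?_) (fun x hx hBx => ?_)
  · -- `B x ∈ 𝔰𝔲(n)` for `x ∈ 𝔰𝔲(n)`
    have hx' : suProj x = x := (fderiv_suProj_apply (0 : Matrix (Fin n) (Fin n) ℂ) x).symm.trans hx
    obtain ⟨hx1, hx2⟩ := (suProj_eq_self_iff x).mp hx'
    refine (fderiv_suProj_apply (0 : Matrix (Fin n) (Fin n) ℂ) _).trans ?_
    change suProj ((Blk[τ, coeConfig U, a]) x) = (Blk[τ, coeConfig U, a]) x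
    rw [hBapply]
    obtain ⟨⟨h1, h2⟩, -⟩ :=
      fderiv_residualIsotopy_single_self p Q κ Qamb hQ2 hQ hlip hQambQ τ U ha hx1 hx2
    exact suProj_eq_self h1 h2
  · -- `B` is injective on `𝔰𝔲(n)`
    have hx' : suProj x = x := (fderiv_suProj_apply (0 : Matrix (Fin n) (Fin n) ℂ) x).symm.trans hx
    obtain ⟨hx1, hx2⟩ := (suProj_eq_self_iff x).mp hx'
    change (Blk[τ, coeConfig U, a]) x = 0 at hBx
    rw [hBapply] at hBx
    obtain ⟨-, hbound⟩ :=
      fderiv_residualIsotopy_single_self p Q κ Qamb hQ2 hQ hlip hQambQ τ U ha hx1 hx2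
    have hδ0 : fderiv ℝ (famb[τ]) (coeConfig U) (Pi.single a (x * (U a : Matrix (Fin n) (Fin n) ℂ))) a = 0 := by
      have h1 := congrArg (fun M => M * (NormedSpace.exp (τ • Qamb ⟨a, ha⟩ (coeConfig U)) *
        (U a : Matrix (Fin n) (Fin n) ℂ))) hBx
      simp only [Matrix.zero_mul] at h1
      rw [Matrix.mul_assoc, ← Matrix.star_eq_conjTranspose, hfU, Matrix.mul_one] at h1
      exact h1
    rw [hδ0, frobNorm_zero] at hbound
    have hκ1 : |τ| * κ ⟨a, ha⟩ (fun f : {f : Edge d L // ¬p f} => U f) < 1 := by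
      have h1 := hκ ⟨a, ha⟩ (fun f : {f : Edge d L // ¬p f} => U f)
      have h2 := hκ0 ⟨a, ha⟩ (fun f : {f : Edge d L // ¬p f} => U f)
      nlinarith [abs_nonneg τ]
    have hx0 : frobNorm x = 0 := by
      have h3 : frobNorm x ≤ 0 := by
        by_contra hcon
        exact absurd hbound (not_le.mpr (mul_pos (by linarith) (lt_of_not_ge hcon)))
      exact le_antisymm h3 (frobNorm_nonneg x)
    rw [frobNorm_eq_norm, norm_eq_zero] at hx0
    exact hx0

end Operator

end Summit.Ventures.LatticeQCDFlow.Exactness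

end
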